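import Summits.CriticalPhenomena.PercolationContinuityZ3.Theorems.PercNearOneGluingAdditiveGluingPeelGlueTransfer
import Summits.CriticalPhenomena.PercolationContinuityZ3.Theorems.PercNearOneGluingAdditiveGluingPairStepOneRelay
import HarnessLib

/-! # Crux `PercNearOneGluing.AdditiveGluing` (stmt-CriticalPhenomena-4576), line `peel`, stub `stub_peel` —
# the GLUING TRANSFER: the block step `T → T ∪ {x}` is the pair step `{s} → {s, x}` in the glued weighting `u/T`

**Part 2/2 (this file): the transfer theorem `peel_of_pairForm`, the hand-off `stub_peel_of_gluedPairForm`, and PEEL at one relay (`peel_oneRelay`, registered stub `stub_peelOneRelay_v22472`).  Part 1/2 = `…PeelGlueTransfer.lean` (clique combinatorics, push-forward bookkeeping, the six identifications).**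

TTRL deep seat `prover-ttrlatt-v22472-d0-0` (variant V22472 = the registered stub `stub_peel` itself); lands
`--supports stmt-CriticalPhenomena-4576`.  No definitions, no named facts.

Write `u/T` for the weighting `u` with every pair inside the block `T` given weight `1` (Kozma–Nitzan's gluing as
"probability 1", `stub_gluePushforward`), and fix `s ∈ T`.  Under `u/T` the block `T` is almost surely an open clique, so
every BLOCK functional of `T` (reach `μ(T ↔ z)`, designated gain `μ(a₀↔b) + μ(a₀↮b, a₀↔T, T↔b)`, block-cluster law
`μ(K_T = W)`) computed in `u` equals the corresponding POINT functional of `s` computed in `u/T`, the block functionals of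
`T ∪ {x}` in `u` equal those of the pair `{s, x}` in `u/T`, and the pocket factors `min_A μ(a ↔ b in Wᶜ)` agree for every
pocket `W ⊇ T` (the only pockets of positive mass).  Consequently (`peel_of_pairForm`) the conclusion of `stub_peel` for
`(u, T, x)` is LITERALLY the conclusion of the pair stub `stub_ratioMonotonePair` for `(u/T, S = {s, x}, s)`: the block step
needs no new correlation inequality beyond the pair step — only its HYPOTHESES differ (the designation `a₀` is the minimiser of
the un-glued `u`, and `x` need not be bad), which is recorded precisely in `stub_peel_of_gluedPairForm`.
[cite: KozmaNitzan2024, §3.1 Remark p. 5 (gluing), §3.2 pp. 12–14]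
-/

namespace Summit.CriticalPhenomena.PercolationContinuityZ3.Theorems

open MeasureTheory Set
open Literature.Probability.LatticeModels (prodBernoulli)
open Literature.Probability.Percolation (BondConfig openConn openConnIn openGraph openCluster)
open scoped BigOperators

noncomputable section
open Classical

section PeelOfPairForm

open Literature.Probability.LatticeModels Literature.Probability.Percolation

variable {n : ℕ}

/-- **GLUING TRANSFER FOR PEEL.**  For `s ∈ T` (no disjointness or badness needed), the conclusion of `stub_peel` for `(u, A, T, x)` follows from
(indeed is) the conclusion of the pair stub `stub_ratioMonotonePair` for the glued weighting `u/T`, the 2-block `{s, x}` and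
the point `s`.  [cite: KozmaNitzan2024, §3.1 Remark p. 5, §3.2 pp. 12–14] -/
theorem peel_of_pairForm (u : Sym2 (Fin n) → unitInterval) (A T : Finset (Fin n)) (b a₀ x s : Fin n) (hb : b ∈ A)
    (hs : s ∈ T)
    (hpair :
      ((prodBernoulli (fun e : Sym2 (Fin n) => if (∀ y ∈ e, y ∈ T) ∧ ¬ e.IsDiag then 1 else u e)).real (openConn s b)
          + (∑ W ∈ (Finset.univ : Finset (Finset (Fin n))).filter (fun W => s ∈ W ∧ Disjoint W A),
              (prodBernoulli (fun e : Sym2 (Fin n) => if (∀ y ∈ e, y ∈ T) ∧ ¬ e.IsDiag then 1 else u e)).real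
                  {ω : BondConfig (Fin n) | openCluster ω s = (W : Set (Fin n))}
                * A.inf' ⟨b, hb⟩ (fun a =>
                    (prodBernoulli (fun e : Sym2 (Fin n) => if (∀ y ∈ e, y ∈ T) ∧ ¬ e.IsDiag then 1 else u e)).real
                      (openConnIn ((W : Set (Fin n))ᶜ) a b)))
          - (prodBernoulli (fun e : Sym2 (Fin n) => if (∀ y ∈ e, y ∈ T) ∧ ¬ e.IsDiag then 1 else u e)).real
              (openConn a₀ b))
        * (∑ W ∈ (Finset.univ : Finset (Finset (Fin n))).filter (fun W => Disjoint W A),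
              (prodBernoulli (fun e : Sym2 (Fin n) => if (∀ y ∈ e, y ∈ T) ∧ ¬ e.IsDiag then 1 else u e)).real
                  {ω : BondConfig (Fin n) | ∀ z : Fin n, (z ∈ W ↔ ω ∈ ⋃ v ∈ ({s, x} : Finset (Fin n)), openConn v z)}
                * A.inf' ⟨b, hb⟩ (fun a =>
                    (prodBernoulli (fun e : Sym2 (Fin n) => if (∀ y ∈ e, y ∈ T) ∧ ¬ e.IsDiag then 1 else u e)).real
                      (openConnIn ((W : Set (Fin n))ᶜ) a b)))
      ≤ ((prodBernoulli (fun e : Sym2 (Fin n) => if (∀ y ∈ e, y ∈ T) ∧ ¬ e.IsDiag then 1 else u e)).real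
              (⋃ v ∈ ({s, x} : Finset (Fin n)), openConn v b)
          + (∑ W ∈ (Finset.univ : Finset (Finset (Fin n))).filter (fun W => Disjoint W A),
              (prodBernoulli (fun e : Sym2 (Fin n) => if (∀ y ∈ e, y ∈ T) ∧ ¬ e.IsDiag then 1 else u e)).real
                  {ω : BondConfig (Fin n) | ∀ z : Fin n, (z ∈ W ↔ ω ∈ ⋃ v ∈ ({s, x} : Finset (Fin n)), openConn v z)}
                * A.inf' ⟨b, hb⟩ (fun a =>
                    (prodBernoulli (fun e : Sym2 (Fin n) => if (∀ y ∈ e, y ∈ T) ∧ ¬ e.IsDiag then 1 else u e)).real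
                      (openConnIn ((W : Set (Fin n))ᶜ) a b)))
          - (prodBernoulli (fun e : Sym2 (Fin n) => if (∀ y ∈ e, y ∈ T) ∧ ¬ e.IsDiag then 1 else u e)).real
              (openConn a₀ b)
          - (prodBernoulli (fun e : Sym2 (Fin n) => if (∀ y ∈ e, y ∈ T) ∧ ¬ e.IsDiag then 1 else u e)).real
              ((openConn a₀ b)ᶜ ∩ (⋃ v ∈ ({s, x} : Finset (Fin n)), openConn a₀ v)
                ∩ (⋃ v ∈ ({s, x} : Finset (Fin n)), openConn v b)))
        * (∑ W ∈ (Finset.univ : Finset (Finset (Fin n))).filter (fun W => s ∈ W ∧ Disjoint W A),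
              (prodBernoulli (fun e : Sym2 (Fin n) => if (∀ y ∈ e, y ∈ T) ∧ ¬ e.IsDiag then 1 else u e)).real
                  {ω : BondConfig (Fin n) | openCluster ω s = (W : Set (Fin n))}
                * A.inf' ⟨b, hb⟩ (fun a =>
                    (prodBernoulli (fun e : Sym2 (Fin n) => if (∀ y ∈ e, y ∈ T) ∧ ¬ e.IsDiag then 1 else u e)).real
                      (openConnIn ((W : Set (Fin n))ᶜ) a b)))) :
    ((prodBernoulli u).real (openConn a₀ b)
        + (prodBernoulli u).real
            ((openConn a₀ b)ᶜ ∩ (⋃ v ∈ insert x T, openConn a₀ v) ∩ (⋃ v ∈ insert x T, openConn v b))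
        - (prodBernoulli u).real (⋃ v ∈ insert x T, openConn v b))
      * (∑ W ∈ (Finset.univ : Finset (Finset (Fin n))).filter (fun W => Disjoint W A),
            (prodBernoulli u).real
                {ω : BondConfig (Fin n) | ∀ z : Fin n, (z ∈ W ↔ ω ∈ ⋃ v ∈ T, openConn v z)}
              * A.inf' ⟨b, hb⟩ (fun a => (prodBernoulli u).real (openConnIn ((W : Set (Fin n))ᶜ) a b)))
    ≤ ((prodBernoulli u).real (openConn a₀ b)
        + (prodBernoulli u).real
            ((openConn a₀ b)ᶜ ∩ (⋃ v ∈ T, openConn a₀ v) ∩ (⋃ v ∈ T, openConn v b))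
        - (prodBernoulli u).real (⋃ v ∈ T, openConn v b))
      * (∑ W ∈ (Finset.univ : Finset (Finset (Fin n))).filter (fun W => Disjoint W A),
            (prodBernoulli u).real
                {ω : BondConfig (Fin n) | ∀ z : Fin n, (z ∈ W ↔ ω ∈ ⋃ v ∈ insert x T, openConn v z)}
              * A.inf' ⟨b, hb⟩ (fun a => (prodBernoulli u).real (openConnIn ((W : Set (Fin n))ᶜ) a b))) := by
  -- (E3) the point's pocket sum in `u/T` is the block's pocket sum `Z_T` in `u`
  have hZT : (∑ W ∈ (Finset.univ : Finset (Finset (Fin n))).filter (fun W => s ∈ W ∧ Disjoint W A),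
              (prodBernoulli (fun e : Sym2 (Fin n) => if (∀ y ∈ e, y ∈ T) ∧ ¬ e.IsDiag then 1 else u e)).real
                  {ω : BondConfig (Fin n) | openCluster ω s = (W : Set (Fin n))}
                * A.inf' ⟨b, hb⟩ (fun a =>
                    (prodBernoulli (fun e : Sym2 (Fin n) => if (∀ y ∈ e, y ∈ T) ∧ ¬ e.IsDiag then 1 else u e)).real
                      (openConnIn ((W : Set (Fin n))ᶜ) a b))) =
      ∑ W ∈ (Finset.univ : Finset (Finset (Fin n))).filter (fun W => Disjoint W A),
            (prodBernoulli u).real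
                {ω : BondConfig (Fin n) | ∀ z : Fin n, (z ∈ W ↔ ω ∈ ⋃ v ∈ T, openConn v z)}
              * A.inf' ⟨b, hb⟩ (fun a => (prodBernoulli u).real (openConnIn ((W : Set (Fin n))ᶜ) a b)) := by
    rw [peelGlue_pocketSum_eq u A T T (subset_refl T) b hb _ (fun W => peelGlue_real_point_cluster u T hs W)]
    -- the pockets not containing `s` are null on the block side
    have hfilter : (Finset.univ : Finset (Finset (Fin n))).filter (fun W => s ∈ W ∧ Disjoint W A) =
        ((Finset.univ : Finset (Finset (Fin n))).filter (fun W => Disjoint W A)).filter (fun W => s ∈ W) := by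
      ext W
      simp only [Finset.mem_filter, Finset.mem_univ, true_and]
      tauto
    rw [hfilter, Finset.sum_filter_of_ne]
    intro W _ hne
    by_contra hsW
    apply hne
    rw [peelGlue_pocket_eq_empty T T W (subset_refl T) (fun h => hsW (h hs)), measureReal_empty, zero_mul]
  -- (E4) the pair's pocket sum in `u/T` is the grown block's pocket sum `Z_{T ∪ x}` in `u`
  have hZTx : (∑ W ∈ (Finset.univ : Finset (Finset (Fin n))).filter (fun W => Disjoint W A),
              (prodBernoulli (fun e : Sym2 (Fin n) => if (∀ y ∈ e, y ∈ T) ∧ ¬ e.IsDiag then 1 else u e)).real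
                  {ω : BondConfig (Fin n) | ∀ z : Fin n, (z ∈ W ↔ ω ∈ ⋃ v ∈ ({s, x} : Finset (Fin n)), openConn v z)}
                * A.inf' ⟨b, hb⟩ (fun a =>
                    (prodBernoulli (fun e : Sym2 (Fin n) => if (∀ y ∈ e, y ∈ T) ∧ ¬ e.IsDiag then 1 else u e)).real
                      (openConnIn ((W : Set (Fin n))ᶜ) a b))) =
      ∑ W ∈ (Finset.univ : Finset (Finset (Fin n))).filter (fun W => Disjoint W A),
            (prodBernoulli u).real
                {ω : BondConfig (Fin n) | ∀ z : Fin n, (z ∈ W ↔ ω ∈ ⋃ v ∈ insert x T, openConn v z)}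
              * A.inf' ⟨b, hb⟩ (fun a => (prodBernoulli u).real (openConnIn ((W : Set (Fin n))ᶜ) a b)) :=
    peelGlue_pocketSum_eq u A T (insert x T) (Finset.subset_insert x T) b hb _
      (fun W => peelGlue_real_pair_cluster u T hs x W) _
  rw [hZT, hZTx, peelGlue_real_point_reach u T hs b, peelGlue_real_pair_reach u T hs x b,
    blockGrowth_glue_real_openConn u T a₀ b] at hpair
  have hgain := peelGlue_real_pair_gain u T hs x a₀ b
  rw [blockGrowth_glue_real_openConn u T a₀ b] at hgain
  -- name the eight numbers and finish by linear algebra (the common product `Z_T · Z_{T∪x}` cancels)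
  set ZT := (∑ W ∈ (Finset.univ : Finset (Finset (Fin n))).filter (fun W => Disjoint W A),
            (prodBernoulli u).real
                {ω : BondConfig (Fin n) | ∀ z : Fin n, (z ∈ W ↔ ω ∈ ⋃ v ∈ T, openConn v z)}
              * A.inf' ⟨b, hb⟩ (fun a => (prodBernoulli u).real (openConnIn ((W : Set (Fin n))ᶜ) a b))) with hZT_def
  set ZTx := (∑ W ∈ (Finset.univ : Finset (Finset (Fin n))).filter (fun W => Disjoint W A),
            (prodBernoulli u).real
                {ω : BondConfig (Fin n) | ∀ z : Fin n, (z ∈ W ↔ ω ∈ ⋃ v ∈ insert x T, openConn v z)}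
              * A.inf' ⟨b, hb⟩ (fun a => (prodBernoulli u).real (openConnIn ((W : Set (Fin n))ᶜ) a b))) with hZTx_def
  set π := (prodBernoulli u).real (openConn a₀ b) with hπ_def
  set GT := (prodBernoulli u).real ((openConn a₀ b)ᶜ ∩ (⋃ v ∈ T, openConn a₀ v) ∩ (⋃ v ∈ T, openConn v b))
    with hGT_def
  set GTx := (prodBernoulli u).real
      ((openConn a₀ b)ᶜ ∩ (⋃ v ∈ insert x T, openConn a₀ v) ∩ (⋃ v ∈ insert x T, openConn v b)) with hGTx_def
  set UT := (prodBernoulli u).real (⋃ v ∈ T, openConn v b) with hUT_def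
  set UTx := (prodBernoulli u).real (⋃ v ∈ insert x T, openConn v b) with hUTx_def
  set G' := (prodBernoulli (fun e : Sym2 (Fin n) => if (∀ y ∈ e, y ∈ T) ∧ ¬ e.IsDiag then 1 else u e)).real
      ((openConn a₀ b)ᶜ ∩ (⋃ v ∈ ({s, x} : Finset (Fin n)), openConn a₀ v)
        ∩ (⋃ v ∈ ({s, x} : Finset (Fin n)), openConn v b)) with hG'_def
  have h3 : (π + GT + G') * ZT = (π + GTx) * ZT := by rw [hgain]
  nlinarith [hpair, h3]

/-- **`stub_peel` from the pair form in the glued weighting** (the precise hand-off): if for every instance of the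
hypotheses of `stub_peel` and every `s ∈ T` the PAIR inequality of `stub_ratioMonotonePair` holds for `(u/T, {s, x}, s)`,
then `stub_peel` holds.  The designation hypothesis stays in the UN-GLUED weighting `u` (it is false to replace it by
minimality in `u/T − s`, and it is not implied by minimality in `u/T`). [cite: KozmaNitzan2024, §3.2 pp. 12–14] -/
theorem stub_peel_of_gluedPairForm
    (h : ∀ (n : ℕ) (u : Sym2 (Fin n) → unitInterval) (A T : Finset (Fin n)) (b a₀ x s : Fin n) (hb : b ∈ A),
      Disjoint T A → 2 ≤ T.card → x ∉ A → x ∉ T → a₀ ∈ A → s ∈ T →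
      (∀ a ∈ A, (prodBernoulli u).real (openConn a₀ b) ≤ (prodBernoulli u).real (openConn a b)) →
      (prodBernoulli u).real (⋃ v ∈ T, openConn v b)
        < (prodBernoulli u).real (openConn a₀ b)
          + (prodBernoulli u).real
              ((openConn a₀ b)ᶜ ∩ (⋃ v ∈ T, openConn a₀ v) ∩ (⋃ v ∈ T, openConn v b)) →
      ((prodBernoulli (fun e : Sym2 (Fin n) => if (∀ y ∈ e, y ∈ T) ∧ ¬ e.IsDiag then 1 else u e)).real (openConn s b)
          + (∑ W ∈ (Finset.univ : Finset (Finset (Fin n))).filter (fun W => s ∈ W ∧ Disjoint W A),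
              (prodBernoulli (fun e : Sym2 (Fin n) => if (∀ y ∈ e, y ∈ T) ∧ ¬ e.IsDiag then 1 else u e)).real
                  {ω : BondConfig (Fin n) | openCluster ω s = (W : Set (Fin n))}
                * A.inf' ⟨b, hb⟩ (fun a =>
                    (prodBernoulli (fun e : Sym2 (Fin n) => if (∀ y ∈ e, y ∈ T) ∧ ¬ e.IsDiag then 1 else u e)).real
                      (openConnIn ((W : Set (Fin n))ᶜ) a b)))
          - (prodBernoulli (fun e : Sym2 (Fin n) => if (∀ y ∈ e, y ∈ T) ∧ ¬ e.IsDiag then 1 else u e)).real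
              (openConn a₀ b))
        * (∑ W ∈ (Finset.univ : Finset (Finset (Fin n))).filter (fun W => Disjoint W A),
              (prodBernoulli (fun e : Sym2 (Fin n) => if (∀ y ∈ e, y ∈ T) ∧ ¬ e.IsDiag then 1 else u e)).real
                  {ω : BondConfig (Fin n) | ∀ z : Fin n, (z ∈ W ↔ ω ∈ ⋃ v ∈ ({s, x} : Finset (Fin n)), openConn v z)}
                * A.inf' ⟨b, hb⟩ (fun a =>
                    (prodBernoulli (fun e : Sym2 (Fin n) => if (∀ y ∈ e, y ∈ T) ∧ ¬ e.IsDiag then 1 else u e)).real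
                      (openConnIn ((W : Set (Fin n))ᶜ) a b)))
      ≤ ((prodBernoulli (fun e : Sym2 (Fin n) => if (∀ y ∈ e, y ∈ T) ∧ ¬ e.IsDiag then 1 else u e)).real
              (⋃ v ∈ ({s, x} : Finset (Fin n)), openConn v b)
          + (∑ W ∈ (Finset.univ : Finset (Finset (Fin n))).filter (fun W => Disjoint W A),
              (prodBernoulli (fun e : Sym2 (Fin n) => if (∀ y ∈ e, y ∈ T) ∧ ¬ e.IsDiag then 1 else u e)).real
                  {ω : BondConfig (Fin n) | ∀ z : Fin n, (z ∈ W ↔ ω ∈ ⋃ v ∈ ({s, x} : Finset (Fin n)), openConn v z)}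
                * A.inf' ⟨b, hb⟩ (fun a =>
                    (prodBernoulli (fun e : Sym2 (Fin n) => if (∀ y ∈ e, y ∈ T) ∧ ¬ e.IsDiag then 1 else u e)).real
                      (openConnIn ((W : Set (Fin n))ᶜ) a b)))
          - (prodBernoulli (fun e : Sym2 (Fin n) => if (∀ y ∈ e, y ∈ T) ∧ ¬ e.IsDiag then 1 else u e)).real
              (openConn a₀ b)
          - (prodBernoulli (fun e : Sym2 (Fin n) => if (∀ y ∈ e, y ∈ T) ∧ ¬ e.IsDiag then 1 else u e)).real
              ((openConn a₀ b)ᶜ ∩ (⋃ v ∈ ({s, x} : Finset (Fin n)), openConn a₀ v)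
                ∩ (⋃ v ∈ ({s, x} : Finset (Fin n)), openConn v b)))
        * (∑ W ∈ (Finset.univ : Finset (Finset (Fin n))).filter (fun W => s ∈ W ∧ Disjoint W A),
              (prodBernoulli (fun e : Sym2 (Fin n) => if (∀ y ∈ e, y ∈ T) ∧ ¬ e.IsDiag then 1 else u e)).real
                  {ω : BondConfig (Fin n) | openCluster ω s = (W : Set (Fin n))}
                * A.inf' ⟨b, hb⟩ (fun a =>
                    (prodBernoulli (fun e : Sym2 (Fin n) => if (∀ y ∈ e, y ∈ T) ∧ ¬ e.IsDiag then 1 else u e)).real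
                      (openConnIn ((W : Set (Fin n))ᶜ) a b)))) :
    ∀ (n : ℕ) (u : Sym2 (Fin n) → unitInterval) (A T : Finset (Fin n)) (b a₀ x : Fin n) (hb : b ∈ A),
      Disjoint T A → 2 ≤ T.card → x ∉ A → x ∉ T → a₀ ∈ A →
      (∀ a ∈ A, (prodBernoulli u).real (openConn a₀ b) ≤ (prodBernoulli u).real (openConn a b)) →
      (prodBernoulli u).real (⋃ v ∈ T, openConn v b)
        < (prodBernoulli u).real (openConn a₀ b)
          + (prodBernoulli u).real
              ((openConn a₀ b)ᶜ ∩ (⋃ v ∈ T, openConn a₀ v) ∩ (⋃ v ∈ T, openConn v b)) →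
      ((prodBernoulli u).real (openConn a₀ b)
          + (prodBernoulli u).real
              ((openConn a₀ b)ᶜ ∩ (⋃ v ∈ insert x T, openConn a₀ v) ∩ (⋃ v ∈ insert x T, openConn v b))
          - (prodBernoulli u).real (⋃ v ∈ insert x T, openConn v b))
        * (∑ W ∈ (Finset.univ : Finset (Finset (Fin n))).filter (fun W => Disjoint W A),
              (prodBernoulli u).real
                  {ω : BondConfig (Fin n) | ∀ z : Fin n, (z ∈ W ↔ ω ∈ ⋃ v ∈ T, openConn v z)}
                * A.inf' ⟨b, hb⟩ (fun a => (prodBernoulli u).real (openConnIn ((W : Set (Fin n))ᶜ) a b)))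
      ≤ ((prodBernoulli u).real (openConn a₀ b)
          + (prodBernoulli u).real
              ((openConn a₀ b)ᶜ ∩ (⋃ v ∈ T, openConn a₀ v) ∩ (⋃ v ∈ T, openConn v b))
          - (prodBernoulli u).real (⋃ v ∈ T, openConn v b))
        * (∑ W ∈ (Finset.univ : Finset (Finset (Fin n))).filter (fun W => Disjoint W A),
              (prodBernoulli u).real
                  {ω : BondConfig (Fin n) | ∀ z : Fin n, (z ∈ W ↔ ω ∈ ⋃ v ∈ insert x T, openConn v z)}
                * A.inf' ⟨b, hb⟩ (fun a => (prodBernoulli u).real (openConnIn ((W : Set (Fin n))ᶜ) a b))) := by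
  intro n u A T b a₀ x hb hTA h2 hxA hxT ha₀ hmin hbad
  obtain ⟨s, hs⟩ : T.Nonempty := Finset.card_pos.1 (by omega)
  exact peel_of_pairForm u A T b a₀ x s hb hs (h n u A T b a₀ x s hb hTA h2 hxA hxT ha₀ hs hmin hbad)

/-- **PEEL at one relay, unconditionally.**  For `A = {b, a₀}`, a block `T ∋ s` disjoint from `A` and a vertex `x ∉ T ∪ A`:
`D_{T∪x} · Z_T ≤ D_T · Z_{T∪x}` — no minimiser, badness or size hypothesis is needed at one relay.  Proof: the gluing transfer
`peel_of_pairForm` and the landed one-relay pair step `pairStep_oneRelay` (van den Berg–Häggström–Kahn twice) in the glued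
weighting `u/T` for the 2-block `{s, x}`. [cite: KozmaNitzan2024, §3.2 pp. 12–14; VandenbergHaggstromKahn2005, Thms. 1.3–1.4 (pp. 6–7)] -/
theorem peel_oneRelay (u : Sym2 (Fin n) → unitInterval) (T : Finset (Fin n)) (b a₀ x s : Fin n)
    (hb : b ∈ ({b, a₀} : Finset (Fin n))) (hTA : Disjoint T ({b, a₀} : Finset (Fin n))) (hs : s ∈ T) (hxT : x ∉ T)
    (hxA : x ∉ ({b, a₀} : Finset (Fin n))) :
    ((prodBernoulli u).real (openConn a₀ b)
        + (prodBernoulli u).real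
            ((openConn a₀ b)ᶜ ∩ (⋃ v ∈ insert x T, openConn a₀ v) ∩ (⋃ v ∈ insert x T, openConn v b))
        - (prodBernoulli u).real (⋃ v ∈ insert x T, openConn v b))
      * (∑ W ∈ (Finset.univ : Finset (Finset (Fin n))).filter (fun W => Disjoint W ({b, a₀} : Finset (Fin n))),
            (prodBernoulli u).real
                {ω : BondConfig (Fin n) | ∀ z : Fin n, (z ∈ W ↔ ω ∈ ⋃ v ∈ T, openConn v z)}
              * ({b, a₀} : Finset (Fin n)).inf' ⟨b, hb⟩
                  (fun a => (prodBernoulli u).real (openConnIn ((W : Set (Fin n))ᶜ) a b)))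
    ≤ ((prodBernoulli u).real (openConn a₀ b)
        + (prodBernoulli u).real
            ((openConn a₀ b)ᶜ ∩ (⋃ v ∈ T, openConn a₀ v) ∩ (⋃ v ∈ T, openConn v b))
        - (prodBernoulli u).real (⋃ v ∈ T, openConn v b))
      * (∑ W ∈ (Finset.univ : Finset (Finset (Fin n))).filter (fun W => Disjoint W ({b, a₀} : Finset (Fin n))),
            (prodBernoulli u).real
                {ω : BondConfig (Fin n) | ∀ z : Fin n, (z ∈ W ↔ ω ∈ ⋃ v ∈ insert x T, openConn v z)}
              * ({b, a₀} : Finset (Fin n)).inf' ⟨b, hb⟩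
                  (fun a => (prodBernoulli u).real (openConnIn ((W : Set (Fin n))ᶜ) a b))) := by
  refine peel_of_pairForm u {b, a₀} T b a₀ x s hb hs ?_
  have hsx : s ≠ x := fun h => hxT (h ▸ hs)
  have hSA : Disjoint ({s, x} : Finset (Fin n)) ({b, a₀} : Finset (Fin n)) := by
    rw [Finset.disjoint_insert_left, Finset.disjoint_singleton_left]
    exact ⟨Finset.disjoint_left.1 hTA hs, hxA⟩
  exact pairStep_oneRelay (fun e : Sym2 (Fin n) => if (∀ y ∈ e, y ∈ T) ∧ ¬ e.IsDiag then 1 else u e) {s, x} b a₀ s hb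
    hSA (Finset.mem_insert_self s {x}) (Finset.card_pair hsx)

/-- Registered helper stub `stub_peelOneRelay_v22472` of crux stmt-CriticalPhenomena-4576 (TTRL deep seat on `stub_peel`): the
universal closure of `peel_oneRelay` — PEEL (`D_{T∪x}·Z_T ≤ D_T·Z_{T∪x}`) at one relay `A = {b, a₀}`, for every block `T ∋ s`
disjoint from `A` and every `x ∉ T ∪ A`, with no further hypothesis. [cite: KozmaNitzan2024, §3.2 pp. 12–14] -/
theorem stub_peelOneRelay_v22472 : ∀ (n : ℕ) (u : Sym2 (Fin n) → unitInterval) (T : Finset (Fin n)) (b a₀ x s : Fin n) (hb : b ∈ ({b, a₀} : Finset (Fin n))), Disjoint T ({b, a₀} : Finset (Fin n)) → s ∈ T → x ∉ T → x ∉ ({b, a₀} : Finset (Fin n)) → ((Literature.Probability.LatticeModels.prodBernoulli u).real (Literature.Probability.Percolation.openConn a₀ b) + (Literature.Probability.LatticeModels.prodBernoulli u).real ((Literature.Probability.Percolation.openConn a₀ b)ᶜ ∩ (⋃ v ∈ insert x T, Literature.Probability.Percolation.openConn a₀ v) ∩ (⋃ v ∈ insert x T, Literature.Probability.Percolation.openConn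 v b)) - (Literature.Probability.LatticeModels.prodBernoulli u).real (⋃ v ∈ insert x T, Literature.Probability.Percolation.openConn v b)) * (∑ W ∈ (Finset.univ : Finset (Finset (Fin n))).filter (fun W => Disjoint W ({b, a₀} : Finset (Fin n))), (Literature.Probability.LatticeModels.prodBernoulli u).real {ω : Literature.Probability.Percolation.BondConfig (Fin n) | ∀ z : Fin n, (z ∈ W ↔ ω ∈ ⋃ v ∈ T, Literature.Probability.Percolation.openConn v z)} * ({b, a₀} : Finset (Fin n)).inf' ⟨b, hb⟩ (fun a => (Literature.Probability.LatticeModels.prodBernoulli u).real (Literature.Probability.Percolation.openConnIn ((W : Set (Fin n))ᶜ) a b))) ≤ ((Literature.Probability.LatticeModels.prodBernoulli u).real (Literature.Probability.Percolation.openConn a₀ b) + (Literature.Probability.LatticeModels.prodBernoulli u).real ((Literature.Probability.Percolation.openConn a₀ b)ᶜ ∩ (⋃ v ∈ T, Literature.Probability.Percolation.openConn a₀ v) ∩ (⋃ v ∈ T, Literature.Probability.Percolation.openConn v b)) - (Literature.Probability.LatticeModels.prodBernoulli u).real (⋃ v ∈ T, Literature.Probability.Percolation.openConn v b)) * (∑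 W ∈ (Finset.univ : Finset (Finset (Fin n))).filter (fun W => Disjoint W ({b, a₀} : Finset (Fin n))), (Literature.Probability.LatticeModels.prodBernoulli u).real {ω : Literature.Probability.Percolation.BondConfig (Fin n) | ∀ z : Fin n, (z ∈ W ↔ ω ∈ ⋃ v ∈ insert x T, Literature.Probability.Percolation.openConn v z)} * ({b, a₀} : Finset (Fin n)).inf' ⟨b, hb⟩ (fun a => (Literature.Probability.LatticeModels.prodBernoulli u).real (Literature.Probability.Percolation.openConnIn ((W : Set (Fin n))ᶜ) a b))) :=
  fun _ u T b a₀ x s hb hTA hs hxT hxA => peel_oneRelay u T b a₀ x s hb hTA hs hxT hxA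

end PeelOfPairForm

end

end Summit.CriticalPhenomena.PercolationContinuityZ3.Theorems
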